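import Mathlib
import Summits.KontsevichZagierPeriods.KontsevichZagierPeriods.Theorems.SoloInformedZetaFourDual
import HarnessLib
import HarnessLib.Audit

/-!
# SoloInformed — the Möbius telescope for the index `(2,2)`: the step

Solo programme `solo-KontsevichZagierPeriods-informed`, session s45 (PART XVI, THEOREM XXXIII with
`k = (2,2)`). Coordinates `x = (c, d, a, b) = (x₀, x₁, x₂, x₃)`, block `2 = {c, d}` (active
`u = c = x₀`, `Q = X₁`), block `1 = {a, b}` (`ω = X₂X₃`), `C = 1`, `D = (0,1)⁴`. The generic step
`SoloInformedTelDatum.telescope` gives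
`[(0,1)⁴ ∩ {x₂x₃ < x₀}, 1/((1 − x₀x₁)(1 − x₂x₃))] − [(0,1)⁴, 1/((1 − x₀x₁)(1 − x₀x₁x₂x₃))] ∈ relations`,
i.e. `[garland (2,2)] ≡ [S⋆(2,2)]`; the two sides are resolved into Kontsevich's simplex
representations in `SoloInformedZetaTwoTwoGarland.lean` / `SoloInformedZetaTwoTwoSum.lean`,
yielding `4·mzvClass [3,1] = mzvClass [4]` by telescope moves alone.
-/

noncomputable section

open MeasureTheory Set MvPolynomial
open Literature.ModelTheory.ExponentialFields Literature.NumberTheory.Transcendental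
open Literature.NumberTheory.Transcendental.KZ

namespace Summit.KontsevichZagierPeriods.KontsevichZagierPeriods.Theorems

/-! ## 1. The datum `(i, Q, ω, C, D) = (0, X₁, X₂X₃, 1, (0,1)⁴)` -/

/-- `Q = X₁`. -/
def soloInformedT22Q : MvPolynomial (Fin 4) ℚ := X 1
/-- `ω = X₂ X₃`. -/
def soloInformedT22Ω : MvPolynomial (Fin 4) ℚ := X 2 * X 3

/-- Auxiliary ((2,2) telescope): `soloInformed_aeval_T22Q`. -/
@[simp] theorem soloInformed_aeval_T22Q (x : Fin 4 → ℝ) : (aeval x soloInformedT22Q : ℝ) = x 1 := by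
  simp [soloInformedT22Q]
/-- Auxiliary ((2,2) telescope): `soloInformed_aeval_T22Ω`. -/
@[simp] theorem soloInformed_aeval_T22Ω (x : Fin 4 → ℝ) :
    (aeval x soloInformedT22Ω : ℝ) = x 2 * x 3 := by
  simp [soloInformedT22Ω]

/-- `f₁ = 1/((1 − x₁x₀)(1 − x₂x₃))`. -/
theorem soloInformed_T22F1_eq (x : Fin 4 → ℝ) :
    soloInformedStepF1 0 soloInformedT22Q soloInformedT22Ω 1 x =
      1 / ((1 - x 1 * x 0) * (1 - x 2 * x 3)) := by
  simp [soloInformedStepF1]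

/-- `S = 1/((1 − x₁x₀)(1 − x₁x₀(x₂x₃)))`. -/
theorem soloInformed_T22FS_eq (x : Fin 4 → ℝ) :
    soloInformedStepFS 0 soloInformedT22Q soloInformedT22Ω 1 x =
      1 / ((1 - x 1 * x 0) * (1 - x 1 * x 0 * (x 2 * x 3))) := by
  simp [soloInformedStepFS]

section bounds
variable {x : Fin 4 → ℝ}

/-- `0 < 1 − x₁x₀` on the cube. -/
theorem soloInformed_T22_pos1 (hx : x ∈ soloInformedOpenCube 4) : 0 < 1 - x 1 * x 0 := by
  have h0 := hx 0; have h1 := hx 1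
  nlinarith [mul_pos h1.1 h0.1]

/-- `0 < 1 − x₂x₃` on the cube. -/
theorem soloInformed_T22_pos2 (hx : x ∈ soloInformedOpenCube 4) : 0 < 1 - x 2 * x 3 := by
  have h2 := hx 2; have h3 := hx 3
  nlinarith [mul_pos h2.1 h3.1]

/-- `0 < 1 − x₁x₀(x₂x₃)` on the cube. -/
theorem soloInformed_T22_pos3 (hx : x ∈ soloInformedOpenCube 4) :
    0 < 1 - x 1 * x 0 * (x 2 * x 3) := by
  have h0 := hx 0; have h1 := hx 1; have h2 := hx 2; have h3 := hx 3
  have h10 : x 1 * x 0 < 1 := by nlinarith [mul_pos h1.1 h0.1]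
  have h23 : x 2 * x 3 < 1 := by nlinarith [mul_pos h2.1 h3.1]
  nlinarith [mul_pos (mul_pos h1.1 h0.1) (mul_pos h2.1 h3.1), mul_pos h1.1 h0.1]

/-- `1/(1 − x₁x₀) ≤ (1−x₀)^{−1/2}(1−x₁)^{−1/2}`. -/
theorem soloInformed_T22_dom1 (hx : x ∈ soloInformedOpenCube 4) :
    1 / (1 - x 1 * x 0) ≤ (1 - x 0) ^ (-(1 / 2 : ℝ)) * (1 - x 1) ^ (-(1 / 2 : ℝ)) := by
  have h0 := hx 0; have h1 := hx 1
  rw [mul_comm (x 1)]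
  exact soloInformed_one_div_one_sub_mul_le (α := 1 / 2) (β := 1 / 2) h0.1.le h0.2 h1.1.le h1.2
    (by norm_num) (by norm_num) (by norm_num)

/-- `1/(1 − x₂x₃) ≤ (1−x₂)^{−1/2}(1−x₃)^{−1/2}`. -/
theorem soloInformed_T22_dom2 (hx : x ∈ soloInformedOpenCube 4) :
    1 / (1 - x 2 * x 3) ≤ (1 - x 2) ^ (-(1 / 2 : ℝ)) * (1 - x 3) ^ (-(1 / 2 : ℝ)) := by
  have h2 := hx 2; have h3 := hx 3
  exact soloInformed_one_div_one_sub_mul_le (α := 1 / 2) (β := 1 / 2) h2.1.le h2.2 h3.1.le h3.2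
    (by norm_num) (by norm_num) (by norm_num)

/-- `1/(1 − x₁x₀(x₂x₃)) ≤ 1/(1 − x₂x₃)`. -/
theorem soloInformed_T22_dom3 (hx : x ∈ soloInformedOpenCube 4) :
    1 / (1 - x 1 * x 0 * (x 2 * x 3)) ≤ 1 / (1 - x 2 * x 3) := by
  have h0 := hx 0; have h1 := hx 1; have h2 := hx 2; have h3 := hx 3
  refine one_div_le_one_div_of_le (soloInformed_T22_pos2 hx) ?_
  have h10 : x 1 * x 0 ≤ 1 := by nlinarith [mul_pos h1.1 h0.1]
  nlinarith [mul_nonneg (mul_nonneg h1.1.le h0.1.le) (mul_nonneg h2.1.le h3.1.le),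
    mul_nonneg h2.1.le h3.1.le,
    mul_le_mul_of_nonneg_right h10 (mul_nonneg h2.1.le h3.1.le)]

/-- **Domination of `f₁`**: `f₁ ≤ ∏ (1−xⱼ)^{−1/2}` on the cube. -/
theorem soloInformed_T22F1_le_W (hx : x ∈ soloInformedOpenCube 4) :
    1 / ((1 - x 1 * x 0) * (1 - x 2 * x 3)) ≤ soloInformedW soloInformedZ4E2 x := by
  have h0 := hx 0; have h1 := hx 1; have h2 := hx 2; have h3 := hx 3
  calc 1 / ((1 - x 1 * x 0) * (1 - x 2 * x 3)) = 1 / (1 - x 1 * x 0) * (1 / (1 - x 2 * x 3)) := by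
        rw [one_div_mul_one_div]
    _ ≤ (1 - x 0) ^ (-(1 / 2 : ℝ)) * (1 - x 1) ^ (-(1 / 2 : ℝ)) *
        ((1 - x 2) ^ (-(1 / 2 : ℝ)) * (1 - x 3) ^ (-(1 / 2 : ℝ))) :=
        mul_le_mul (soloInformed_T22_dom1 hx) (soloInformed_T22_dom2 hx)
          (one_div_pos.2 (soloInformed_T22_pos2 hx)).le
          (mul_nonneg (Real.rpow_nonneg (by linarith) _) (Real.rpow_nonneg (by linarith) _))
    _ = soloInformedW soloInformedZ4E2 x := by
        rw [soloInformedW_eq4]; simp only [soloInformedZ4E2_apply]; ring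

/-- **Domination of `S`**: `S ≤ ∏ (1−xⱼ)^{−1/2}` on the cube. -/
theorem soloInformed_T22FS_le_W (hx : x ∈ soloInformedOpenCube 4) :
    1 / ((1 - x 1 * x 0) * (1 - x 1 * x 0 * (x 2 * x 3))) ≤ soloInformedW soloInformedZ4E2 x := by
  have h0 := hx 0; have h1 := hx 1; have h2 := hx 2; have h3 := hx 3
  calc 1 / ((1 - x 1 * x 0) * (1 - x 1 * x 0 * (x 2 * x 3)))
        = 1 / (1 - x 1 * x 0) * (1 / (1 - x 1 * x 0 * (x 2 * x 3))) := by rw [one_div_mul_one_div]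
    _ ≤ (1 - x 0) ^ (-(1 / 2 : ℝ)) * (1 - x 1) ^ (-(1 / 2 : ℝ)) *
        ((1 - x 2) ^ (-(1 / 2 : ℝ)) * (1 - x 3) ^ (-(1 / 2 : ℝ))) :=
        mul_le_mul (soloInformed_T22_dom1 hx) ((soloInformed_T22_dom3 hx).trans
          (soloInformed_T22_dom2 hx)) (one_div_pos.2 (soloInformed_T22_pos3 hx)).le
          (mul_nonneg (Real.rpow_nonneg (by linarith) _) (Real.rpow_nonneg (by linarith) _))
    _ = soloInformedW soloInformedZ4E2 x := by
        rw [soloInformedW_eq4]; simp only [soloInformedZ4E2_apply]; ring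

end bounds

/-- The domain of the left side: `(0,1)⁴ ∩ {x₂x₃ < x₀}`. -/
theorem soloInformed_T22D1_eq :
    soloInformedOpenCube 4 ∩ {x : Fin 4 → ℝ | (aeval x soloInformedT22Ω : ℝ) < x 0}
      = soloInformedOpenCube 4 ∩ {x | x 2 * x 3 < x 0} := by
  ext x; simp

/-- Auxiliary ((2,2) telescope): `soloInformed_measurableSet_T22D1`. -/
theorem soloInformed_measurableSet_T22D1 :
    MeasurableSet (soloInformedOpenCube 4 ∩ {x : Fin 4 → ℝ | x 2 * x 3 < x 0}) :=
  (soloInformed_measurableSet_openCube 4).inter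
    (measurableSet_lt ((measurable_pi_apply 2).mul (measurable_pi_apply 3)) (measurable_pi_apply 0))

/-- Integrability of `f₁` on `(0,1)⁴ ∩ {x₂x₃ < x₀}`. -/
theorem soloInformed_integrableOn_T22F1 :
    IntegrableOn (soloInformedStepF1 0 soloInformedT22Q soloInformedT22Ω 1)
      (soloInformedOpenCube 4 ∩ {x : Fin 4 → ℝ | (aeval x soloInformedT22Ω : ℝ) < x 0}) := by
  rw [soloInformed_T22D1_eq]
  refine soloInformed_integrableOn_of_le_W soloInformed_measurableSet_T22D1 inter_subset_left
    (soloInformed_continuousOn_stepF1 0 _ _ _ fun x hx => ?_) soloInformedZ4E2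
    soloInformedZ4E2_lt_one 1 fun x hx => ?_
  · simpa using (mul_pos (soloInformed_T22_pos1 hx.1) (soloInformed_T22_pos2 hx.1)).ne'
  · rw [soloInformed_T22F1_eq, one_mul, abs_of_pos (one_div_pos.2 (mul_pos
      (soloInformed_T22_pos1 hx.1) (soloInformed_T22_pos2 hx.1)))]
    exact soloInformed_T22F1_le_W hx.1

/-- Integrability of `S` on `(0,1)⁴`. -/
theorem soloInformed_integrableOn_T22FS :
    IntegrableOn (soloInformedStepFS 0 soloInformedT22Q soloInformedT22Ω 1) (soloInformedOpenCube 4) := by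
  refine soloInformed_integrableOn_of_le_W (soloInformed_measurableSet_openCube 4) subset_rfl
    (soloInformed_continuousOn_stepFS 0 _ _ _ fun x hx => ?_) soloInformedZ4E2
    soloInformedZ4E2_lt_one 1 fun x hx => ?_
  · simpa using (mul_pos (soloInformed_T22_pos1 hx) (soloInformed_T22_pos3 hx)).ne'
  · rw [soloInformed_T22FS_eq, one_mul, abs_of_pos (one_div_pos.2 (mul_pos
      (soloInformed_T22_pos1 hx) (soloInformed_T22_pos3 hx)))]
    exact soloInformed_T22FS_le_W hx

/-- **The `(2,2)` telescope datum** `(i, Q, ω, C, D) = (0, X₁, X₂X₃, 1, (0,1)⁴)`. -/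
def soloInformedT22Datum : SoloInformedTelDatum 4 where
  i := 0
  Q := soloInformedT22Q
  Ω := soloInformedT22Ω
  C := 1
  D := soloInformedOpenCube 4
  isSemialgebraic_D := isSemialgebraic_soloInformedOpenCube 4
  measurableSet_D := soloInformed_measurableSet_openCube 4
  update_mem := fun x hx t ht0 ht1 j => by
    by_cases hj : j = 0
    · subst hj; simpa using ⟨ht0, ht1⟩
    · rw [Function.update_of_ne hj]; exact hx j
  mem_Ioo := fun x hx => hx 0
  vars_Q := by simp [soloInformedT22Q, vars_X]
  vars_Ω := fun h => by
    have hm := (vars_mul (X 2 : MvPolynomial (Fin 4) ℚ) (X 3)) h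
    simp [vars_X] at hm
  vars_C := by simp [vars_one]
  Q_bound := fun x hx => by simpa using ⟨(hx 1).1.le, (hx 1).2⟩
  Ω_bound := fun x hx => by
    have h2 := hx 2; have h3 := hx 3
    simp only [soloInformed_aeval_T22Ω]
    exact ⟨mul_pos h2.1 h3.1, by nlinarith [mul_pos h2.1 h3.1]⟩
  C_pos := fun x _ => by simp
  integrableOn_F1 := soloInformed_integrableOn_T22F1
  integrableOn_FS := soloInformed_integrableOn_T22FS

/-- **THE `(2,2)` STEP (KERNEL):**
`[(0,1)⁴ ∩ {x₂x₃ < x₀}, 1/((1 − x₀x₁)(1 − x₂x₃))] − [(0,1)⁴, 1/((1 − x₀x₁)(1 − x₀x₁x₂x₃))] ∈ relations`. -/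
theorem soloInformed_t22_telescope :
    of soloInformedT22Datum.R1 - of soloInformedT22Datum.R2 ∈ relations :=
  soloInformedT22Datum.telescope

/-- Auxiliary ((2,2) telescope): `soloInformedT22Datum_i`. -/
@[simp] theorem soloInformedT22Datum_i : soloInformedT22Datum.i = 0 := rfl
/-- Auxiliary ((2,2) telescope): `soloInformedT22Datum_D`. -/
@[simp] theorem soloInformedT22Datum_D : soloInformedT22Datum.D = soloInformedOpenCube 4 := rfl
/-- Auxiliary ((2,2) telescope): `soloInformedT22Datum_Q`. -/
@[simp] theorem soloInformedT22Datum_Q : soloInformedT22Datum.Q = soloInformedT22Q := rfl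
/-- Auxiliary ((2,2) telescope): `soloInformedT22Datum_Ω`. -/
@[simp] theorem soloInformedT22Datum_Ω : soloInformedT22Datum.Ω = soloInformedT22Ω := rfl
/-- Auxiliary ((2,2) telescope): `soloInformedT22Datum_C`. -/
@[simp] theorem soloInformedT22Datum_C : soloInformedT22Datum.C = 1 := rfl

/-- Auxiliary ((2,2) telescope): `soloInformedT22_R1_domain`. -/
theorem soloInformedT22_R1_domain :
    soloInformedT22Datum.R1.domain = soloInformedOpenCube 4 ∩ {x | x 2 * x 3 < x 0} := by
  rw [SoloInformedTelDatum.R1_domain]; ext x; simp [SoloInformedTelDatum.ω]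

/-- Auxiliary ((2,2) telescope): `soloInformedT22_R1_integrand`. -/
theorem soloInformedT22_R1_integrand (x : Fin 4 → ℝ) :
    soloInformedT22Datum.R1.integrand x = 1 / ((1 - x 1 * x 0) * (1 - x 2 * x 3)) := by
  rw [SoloInformedTelDatum.R1_integrand]; exact soloInformed_T22F1_eq x

/-- Auxiliary ((2,2) telescope): `soloInformedT22_R2_domain`. -/
theorem soloInformedT22_R2_domain : soloInformedT22Datum.R2.domain = soloInformedOpenCube 4 := rfl

/-- Auxiliary ((2,2) telescope): `soloInformedT22_R2_integrand`. -/
theorem soloInformedT22_R2_integrand (x : Fin 4 → ℝ) :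
    soloInformedT22Datum.R2.integrand x = 1 / ((1 - x 1 * x 0) * (1 - x 1 * x 0 * (x 2 * x 3))) := by
  rw [SoloInformedTelDatum.R2_integrand]; exact soloInformed_T22FS_eq x

end Summit.KontsevichZagierPeriods.KontsevichZagierPeriods.Theorems
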